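import Summits.Ventures.CertifiedManyBodySolver.Theorems.TcThermcert1FreeGasOneBodyDecay
import Summits.Ventures.CertifiedManyBodySolver.Theorems.TcThermcert1FreeGasCanonicalPullThrough
import Literature.MathematicalPhysics.QuantumLattice.SpinSectorPartitionFnTransfer
import Literature.MathematicalPhysics.QuantumLattice.ApproximatingHamiltonianProofs
import Literature.MathematicalPhysics.QuantumLattice.FermionLiebRobinson
import HarnessLib

/-!
# Free-gas (`U = 0`) current clustering for TcThermcert1's Hypothesis C — part 3: sector bounds for a short-range free gas

Helper file for route `TcThermcert1` (crux K1′ `ThermalStiffnessCeilingU8b8_le_7o44`, item `stmt-Ventures-24560`; line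
`Cruxes/ThermalStiffnessCeilingU8b8_le_7o44/Lines/gauge_qbp_far_seam.lean` v1.4, Hypothesis C = `CurrentClustering U n β ξ`).
GENERIC in the finite site set `Λ` (the torus is an instance): `h` is a symmetric, spin-diagonal one-body matrix on `Orb Λ` whose rows
have absolute sum `≤ κ` and whose non-zero entries join sites at `D`-distance `≤ 1` for an `ℕ`-valued pseudo-metric `D` on `Λ`
(free torus: `κ = 4`, `D = dist_∞`). For the canonical `(N↑, N↓)`-sectors of `H = dΓ(h)`:

* §1 (sector bookkeeping): `c_{x↑} P_{0,b} = 0`, `c_{x↓} P_{a,0} = 0`; `P_{a,b} e^{−βH} ≥ 0` for a sector-preserving Hermitian `H`, hence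
  `|tr(P_{a,b} e^{−βH} B)| ≤ ‖B‖ · Re tr(P_{a,b} e^{−βH})`; `‖(c_k A − A c_k) c†_p‖ ≤ 2‖A‖`; even observables on `orbSet X` commute
  with the annihilators off `X`;
* §2 (one-body): `dΓ(h)` preserves sectors; `e^{c h}` is spin-block-diagonal and symmetric; `(e^{−βh})^n = e^{−nβh}`; the decay
  `‖((e^{−βh})^{j+1})_{(x,σ),(y,τ)}‖ ≤ q^d e^{(κβ+ε)(j+1)}` for `d ≤ D(x,y)`, `q ≥ κβ/ε`; the commutator rate `‖[dΓ(h), c†]‖ ≤ κ`;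
* §3 (sector ratios, from the tree's `partitionFn_spinSector_transfer_up/_down`): `Z(M−i, b) ≤ ρ^i Z(M,b)`, `Z(a, M−i) ≤ ρ^i Z(a,M)` with
  `ρ = (n/(2−n)) e^{2κβ}`, whenever `M ≤ n|Λ|/2`, `0 ≤ n ≤ 1`, `β ≥ 0`.

HONEST FRAMING: finite-dimensional statements about FREE lattice fermions; nothing here touches `U = 8`, the bet C8 or `T_c`;
superconductivity in the Hubbard model is NOT proved (or disproved) by any of this.
-/

noncomputable section

namespace Summit.Ventures.CertifiedManyBodySolver.Theorems.TcThermcert1.FreeGasCurrentClustering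

open NormedSpace Matrix Finset
open Literature.MathematicalPhysics.QuantumLattice
open scoped Matrix.Norms.L2Operator ComplexOrder

variable {Λ : Type*} [LinearOrder Λ] [Fintype Λ]

/-! ## §1 Sector bookkeeping -/

section Sectors

/-- `c_{x↑} P_{0,b} = 0`: no up electron can be removed from the sector `N↑ = 0`. -/
theorem annihilation_up_mul_spinSectorProj_zero (b : ℕ) (x : Λ) :
    annihilation (orb x 0) * (spinSectorProj 0 b : Matrix (Finset (Orb Λ)) _ ℂ) = 0 := by
  ext s t
  rw [spinSectorProj, mul_diagonal, annihilation_apply, Matrix.zero_apply]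
  by_cases h : orb x 0 ∉ s ∧ t = insert (orb x 0) s
  · rw [if_pos h, if_neg, mul_zero]
    rintro ⟨ht, -⟩
    have hx : x ∈ upPart t := by rw [mem_upPart, h.2]; exact Finset.mem_insert_self _ _
    rw [Finset.card_eq_zero] at ht
    rw [ht] at hx
    exact absurd hx (Finset.notMem_empty _)
  · rw [if_neg h, zero_mul]

/-- `c_{x↓} P_{a,0} = 0`: no down electron can be removed from the sector `N↓ = 0`. -/
theorem annihilation_down_mul_spinSectorProj_zero (a : ℕ) (x : Λ) :
    annihilation (orb x 1) * (spinSectorProj a 0 : Matrix (Finset (Orb Λ)) _ ℂ) = 0 := by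
  ext s t
  rw [spinSectorProj, mul_diagonal, annihilation_apply, Matrix.zero_apply]
  by_cases h : orb x 1 ∉ s ∧ t = insert (orb x 1) s
  · rw [if_pos h, if_neg, mul_zero]
    rintro ⟨-, ht⟩
    have hx : x ∈ downPart t := by rw [mem_downPart, h.2]; exact Finset.mem_insert_self _ _
    rw [Finset.card_eq_zero] at ht
    rw [ht] at hx
    exact absurd hx (Finset.notMem_empty _)
  · rw [if_neg h, zero_mul]

/-- The sector projection commutes with the Gibbs weight of a sector-preserving matrix. -/
theorem spinSectorProj_mul_gibbsWeight_comm {H : Matrix (Finset (Orb Λ)) (Finset (Orb Λ)) ℂ} (hP : PreservesSectors H)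
    (β : ℝ) (a b : ℕ) : spinSectorProj a b * gibbsWeight β H = gibbsWeight β H * spinSectorProj a b := by
  have hc : Commute (spinSectorProj a b) (-(β : ℂ) • H) :=
    (show Commute (spinSectorProj a b) H from spinSectorProj_mul_comm_of_preservesSectors hP a b).smul_right _
  exact hc.exp_right.eq

/-- **The projected Gibbs weight is positive semidefinite**: `P_{a,b} e^{−βH} = P_{a,b}ᴴ e^{−βH} P_{a,b} ≥ 0`. -/
theorem posSemidef_spinSectorProj_mul_gibbsWeight {H : Matrix (Finset (Orb Λ)) (Finset (Orb Λ)) ℂ} (hH : H.IsHermitian)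
    (hP : PreservesSectors H) (β : ℝ) (a b : ℕ) : (spinSectorProj a b * gibbsWeight β H).PosSemidef := by
  have h : spinSectorProj a b * gibbsWeight β H = (spinSectorProj a b)ᴴ * gibbsWeight β H * spinSectorProj a b := by
    rw [spinSectorProj_conjTranspose, Matrix.mul_assoc, ← spinSectorProj_mul_gibbsWeight_comm hP, ← Matrix.mul_assoc,
      spinSectorProj_mul_self]
  rw [h]
  exact (posDef_gibbsWeight β hH).posSemidef.conjTranspose_mul_mul_same _

/-- The projected partition function `tr(P_{a,b} e^{−βH})` is a non-negative real. -/
theorem trace_spinSectorProj_mul_gibbsWeight_nonneg {H : Matrix (Finset (Orb Λ)) (Finset (Orb Λ)) ℂ} (hH : H.IsHermitian)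
    (hP : PreservesSectors H) (β : ℝ) (a b : ℕ) : 0 ≤ (spinSectorProj a b * gibbsWeight β H).trace :=
  (posSemidef_spinSectorProj_mul_gibbsWeight hH hP β a b).trace_nonneg

/-- `tr(P_{a,b} e^{−βH})` equals its real part. -/
theorem trace_spinSectorProj_mul_gibbsWeight_eq_re {H : Matrix (Finset (Orb Λ)) (Finset (Orb Λ)) ℂ} (hH : H.IsHermitian)
    (hP : PreservesSectors H) (β : ℝ) (a b : ℕ) :
    (spinSectorProj a b * gibbsWeight β H).trace = (((spinSectorProj a b * gibbsWeight β H).trace).re : ℂ) := by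
  obtain ⟨_, him⟩ := Complex.nonneg_iff.1 (trace_spinSectorProj_mul_gibbsWeight_nonneg hH hP β a b)
  exact Complex.ext (by simp) (by rw [Complex.ofReal_im]; exact him.symm)

/-- **States of the projected weight are bounded by the operator norm**: `|tr(P_{a,b} e^{−βH} B)| ≤ ‖B‖ · Re tr(P_{a,b} e^{−βH})`. -/
theorem norm_trace_spinSectorProj_mul_gibbsWeight_mul_le {H : Matrix (Finset (Orb Λ)) (Finset (Orb Λ)) ℂ} (hH : H.IsHermitian)
    (hP : PreservesSectors H) (β : ℝ) (a b : ℕ) (B : Matrix (Finset (Orb Λ)) (Finset (Orb Λ)) ℂ) :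
    ‖(spinSectorProj a b * gibbsWeight β H * B).trace‖ ≤ ‖B‖ * ((spinSectorProj a b * gibbsWeight β H).trace).re := by
  rw [Matrix.trace_mul_comm]
  exact norm_trace_mul_le_opNorm_mul_re_trace B (posSemidef_spinSectorProj_mul_gibbsWeight hH hP β a b)

/-- The commutator bracket against a local even observable: `‖(c_k A − A c_k) c†_p‖ ≤ 2‖A‖`. -/
theorem norm_commutator_mul_creation_le (A : Matrix (Finset (Orb Λ)) (Finset (Orb Λ)) ℂ) (k p : Orb Λ) :
    ‖(annihilation k * A - A * annihilation k) * creation p‖ ≤ 2 * ‖A‖ := by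
  have hc := norm_creation_le_one (ι := Orb Λ) p
  have ha := norm_annihilation_le_one (ι := Orb Λ) k
  have hA := norm_nonneg A
  have h1 : ‖annihilation k * A‖ ≤ ‖A‖ := by
    refine (norm_mul_le _ _).trans ?_
    calc ‖(annihilation k : Matrix (Finset (Orb Λ)) (Finset (Orb Λ)) ℂ)‖ * ‖A‖ ≤ 1 * ‖A‖ := mul_le_mul_of_nonneg_right ha hA
      _ = ‖A‖ := one_mul _
  have h2 : ‖A * annihilation k‖ ≤ ‖A‖ := by
    refine (norm_mul_le _ _).trans ?_
    calc ‖A‖ * ‖(annihilation k : Matrix (Finset (Orb Λ)) (Finset (Orb Λ)) ℂ)‖ ≤ ‖A‖ * 1 := mul_le_mul_of_nonneg_left ha hA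
      _ = ‖A‖ := mul_one _
  have h3 : ‖annihilation k * A - A * annihilation k‖ ≤ 2 * ‖A‖ := by
    refine (norm_sub_le _ _).trans ?_
    rw [two_mul]
    exact add_le_add h1 h2
  refine (norm_mul_le _ _).trans ?_
  calc ‖annihilation k * A - A * annihilation k‖ * ‖(creation p : Matrix (Finset (Orb Λ)) (Finset (Orb Λ)) ℂ)‖
      ≤ (2 * ‖A‖) * 1 := mul_le_mul h3 hc (norm_nonneg _) (by positivity)
    _ = 2 * ‖A‖ := mul_one _

/-- An even observable supported on `orbSet X` commutes with every annihilator off `X`. -/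
theorem commutator_eq_zero_of_not_mem {X : Finset Λ} {A : Matrix (Finset (Orb Λ)) (Finset (Orb Λ)) ℂ}
    (hA : A ∈ carEvenSubalgebra (orbSet X)) {y : Λ} (hy : y ∉ X) (σ : Fin 2) :
    annihilation (orb y σ) * A - A * annihilation (orb y σ) = 0 := by
  have hdisj : Disjoint (orbSet X) ({orb y σ} : Finset (Orb Λ)) := by
    rw [Finset.disjoint_singleton_right, mem_orbSet]
    exact hy
  have hc := commute_of_mem_carEvenSubalgebra hA (annihilation_mem_carSubalgebra (Finset.mem_singleton_self (orb y σ))) hdisj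
  rw [← hc.eq, sub_self]

end Sectors

/-! ## §2 One-body facts for a symmetric, spin-diagonal, short-range `h` -/

section OneBody

variable (h : Matrix (Orb Λ) (Orb Λ) ℂ)

/-- A spin-diagonal quadratic Hamiltonian `dΓ(h)` conserves `N↑` and `N↓`. -/
theorem preservesSectors_dGamma_of_spinDiag (hspin : ∀ q k : Orb Λ, (ofLex q).2 ≠ (ofLex k).2 → h q k = 0) :
    PreservesSectors (dGamma h) := by
  rw [dGamma_eq, sum_orb_eq_sum_sum]
  refine PreservesSectors.sum fun x _ => PreservesSectors.sum fun σ _ => ?_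
  rw [sum_orb_eq_sum_sum]
  refine PreservesSectors.sum fun y _ => PreservesSectors.sum fun τ _ => ?_
  by_cases hστ : σ = τ
  · subst hστ
    exact (LiebThm1.preservesSectors_hopping x y σ).smul _
  · rw [hspin (orb x σ) (orb y τ) hστ, zero_smul]
    exact PreservesSectors.zero

/-- `e^{c h}` is spin-block-diagonal when `h` is. -/
theorem exp_smul_apply_of_spin_ne (hspin : ∀ q k : Orb Λ, (ofLex q).2 ≠ (ofLex k).2 → h q k = 0) (c : ℂ)
    {q k : Orb Λ} (hqk : (ofLex q).2 ≠ (ofLex k).2) : (exp (c • h)) q k = 0 := by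
  set S : Matrix (Orb Λ) (Orb Λ) ℂ := diagonal fun o => (((ofLex o).2 : ℕ) : ℂ) with hS
  have hcomm : Commute S (c • h) := by
    refine Commute.smul_right ?_ c
    change S * h = h * S
    ext o o'
    rw [hS, diagonal_mul, mul_diagonal]
    by_cases ho : (ofLex o).2 = (ofLex o').2
    · rw [ho, mul_comm]
    · rw [hspin o o' ho, mul_zero, zero_mul]
  have hE := (hcomm.exp_right).eq
  have h1 := congrFun (congrFun hE q) k
  rw [hS, diagonal_mul, mul_diagonal] at h1
  have hne : ((((ofLex q).2 : ℕ) : ℂ)) ≠ (((ofLex k).2 : ℕ) : ℂ) := by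
    intro h'
    exact hqk (Fin.ext (by exact_mod_cast h'))
  have h' : ((((ofLex q).2 : ℕ) : ℂ) - (((ofLex k).2 : ℕ) : ℂ)) * (exp (c • h)) q k = 0 := by
    rw [sub_mul, h1, mul_comm, sub_self]
  exact (mul_eq_zero.1 h').resolve_left (sub_ne_zero.2 hne)

/-- `e^{c h}` is symmetric when `h` is. -/
theorem exp_smul_apply_comm (hsym : ∀ q k : Orb Λ, h q k = h k q) (c : ℂ) (q k : Orb Λ) :
    (exp (c • h)) q k = (exp (c • h)) k q := by
  have ht : (c • h)ᵀ = c • h := by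
    ext o o'
    rw [transpose_apply, Matrix.smul_apply, Matrix.smul_apply, hsym]
  have he := Matrix.exp_transpose (c • h)
  rw [ht] at he
  have := congrFun (congrFun he k) q
  rw [transpose_apply] at this
  exact this.symm

/-- Powers of the one-body Gibbs factor: `(e^{−βh})^n = e^{(−nβ) h}`. -/
theorem exp_neg_smul_pow (β : ℝ) (n : ℕ) : (exp (-((β : ℂ) • h))) ^ n = exp ((-((n : ℂ) * β)) • h) := by
  rw [← Matrix.exp_nsmul, ← Nat.cast_smul_eq_nsmul ℂ, smul_neg, smul_smul, neg_smul]

/-- **Decay of the powers of the one-body Gibbs factor**: if the rows of `h` have absolute sum `≤ κ` and its non-zero entries join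
sites at `D`-distance `≤ 1` (`D` an `ℕ`-valued pseudo-metric), then for `β ≥ 0`, `ε > 0`, `q ≥ κβ/ε` and `d ≤ D(x, y)`:
`‖((e^{−βh})^{j+1})_{(x,σ),(y,τ)}‖ ≤ q^d · e^{(κβ+ε)(j+1)}`. -/
theorem norm_pow_exp_apply_le {κ : ℝ} (hκ : 0 ≤ κ) (hrow : ∀ q, ∑ k, ‖h q k‖ ≤ κ) (D : Λ → Λ → ℕ) (hD0 : ∀ x, D x x = 0)
    (hDt : ∀ x y z, D x z ≤ D x y + D y z) (hstep : ∀ l k : Orb Λ, h l k ≠ 0 → D (ofLex l).1 (ofLex k).1 ≤ 1)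
    {β ε q : ℝ} (hβ : 0 ≤ β) (hε : 0 < ε) (hq : κ * β / ε ≤ q) (j : ℕ)
    (p k : Orb Λ) {d : ℕ} (hd : d ≤ D (ofLex p).1 (ofLex k).1) :
    ‖((exp (-((β : ℂ) • h))) ^ (j + 1)) p k‖ ≤ q ^ d * Real.exp ((κ * β + ε) * (j + 1)) := by
  rw [exp_neg_smul_pow]
  have hc : ‖(-(((j + 1 : ℕ) : ℂ) * β))‖ = (j + 1) * β := by
    rw [norm_neg, norm_mul, Complex.norm_natCast, Complex.norm_real, Real.norm_of_nonneg hβ]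
    push_cast
    ring
  -- the generic walk-counting bound of part 1
  have h0 := norm_exp_apply_le ((-(((j + 1 : ℕ) : ℂ) * β)) • h) (fun p k : Orb Λ => D (ofLex p).1 (ofLex k).1)
    (fun p => hD0 _) (fun p l k => hDt _ _ _)
    (fun l k hlk => hstep l k (by rw [Matrix.smul_apply, smul_eq_mul] at hlk; exact right_ne_zero_of_mul hlk))
    (m := κ * ((j + 1) * β)) (by positivity) ?_ p k hd
  swap
  · intro p
    simp only [Matrix.smul_apply, smul_eq_mul, norm_mul, ← Finset.mul_sum, hc]
    calc (j + 1) * β * ∑ k, ‖h p k‖ ≤ (j + 1) * β * κ := mul_le_mul_of_nonneg_left (hrow p) (by positivity)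
      _ = κ * ((j + 1) * β) := by ring
  refine h0.trans ?_
  have hq0 : 0 ≤ κ * β / ε := div_nonneg (by positivity) hε.le
  have hq' : 0 ≤ q := hq0.trans hq
  have h1 : (κ * ((j + 1 : ℝ) * β)) ^ d / d.factorial = (κ * β / ε) ^ d * ((ε * (j + 1)) ^ d / d.factorial) := by
    rw [mul_div_assoc', ← mul_pow]
    congr 2
    field_simp
  have h2 : (ε * (j + 1)) ^ d / d.factorial ≤ Real.exp (ε * (j + 1)) :=
    Real.pow_div_factorial_le_exp (ε * (j + 1)) (by positivity) d
  rw [h1]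
  calc (κ * β / ε) ^ d * ((ε * (j + 1)) ^ d / d.factorial) * Real.exp (κ * ((j + 1) * β))
      ≤ q ^ d * Real.exp (ε * (j + 1)) * Real.exp (κ * ((j + 1) * β)) := by gcongr
    _ = q ^ d * Real.exp ((κ * β + ε) * (j + 1)) := by
        rw [mul_assoc, ← Real.exp_add]
        congr 2
        ring

/-- **The commutator rate of a quadratic Hamiltonian**: `‖[dΓ(h), c†_o]‖ ≤ κ` when the columns (= rows, `h` symmetric) of `h` have
absolute sum `≤ κ`. -/
theorem norm_commutator_dGamma_creation_le (hsym : ∀ q k : Orb Λ, h q k = h k q) {κ : ℝ} (hrow : ∀ q, ∑ k, ‖h q k‖ ≤ κ)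
    (o : Orb Λ) : ‖dGamma h * creation o - creation o * dGamma h‖ ≤ κ := by
  rw [dGamma_commutator_creation]
  calc ‖∑ k, h k o • (creation k : Matrix (Finset (Orb Λ)) (Finset (Orb Λ)) ℂ)‖
      ≤ ∑ k, ‖h k o • (creation k : Matrix (Finset (Orb Λ)) (Finset (Orb Λ)) ℂ)‖ := norm_sum_le _ _
    _ ≤ ∑ k, ‖h o k‖ := Finset.sum_le_sum fun k _ => by
        rw [norm_smul, hsym k o]
        exact (mul_le_mul_of_nonneg_left (norm_creation_le_one k) (norm_nonneg _)).trans (le_of_eq (mul_one _))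
    _ ≤ κ := hrow o

end OneBody

/-! ## §3 Sector ratios for `dΓ(h)` (Ruelle-type transfer, free commutator rate `κ`) -/

section Ratio

variable (h : Matrix (Orb Λ) (Orb Λ) ℂ) (hh : h.IsHermitian) (hsym : ∀ q k : Orb Λ, h q k = h k q)
  (hspin : ∀ q k : Orb Λ, (ofLex q).2 ≠ (ofLex k).2 → h q k = 0) {κ : ℝ} (hκ : 0 ≤ κ) (hrow : ∀ q, ∑ k, ‖h q k‖ ≤ κ)
include hh hsym hspin hκ hrow

/-- **One-step sector ratio, spin up**: for `β ≥ 0`, `0 ≤ n ≤ 1` and `a + 1 ≤ M ≤ n|Λ|/2`,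
`Z(a, b) ≤ (n/(2−n)) e^{2κβ} · Z(a+1, b)` with `Z(a,b) = Re tr(P_{a,b} e^{−β dΓ(h)})`. -/
theorem sectorTrace_up_le_mul_succ {β n : ℝ} (hβ : 0 ≤ β) (hn0 : 0 ≤ n) (hn1 : n ≤ 1) {M : ℕ}
    (hM : (M : ℝ) ≤ n * (Fintype.card Λ : ℝ) / 2) {a : ℕ} (ha : a + 1 ≤ M) (b : ℕ) :
    ((spinSectorProj a b * gibbsWeight β (dGamma h)).trace).re ≤
      (n / (2 - n) * Real.exp (2 * κ * β)) * ((spinSectorProj (a + 1) b * gibbsWeight β (dGamma h)).trace).re := by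
  have hH := isHermitian_dGamma hh
  have hP := preservesSectors_dGamma_of_spinDiag h hspin
  have ha1 : ((a + 1 : ℕ) : ℝ) ≤ n * (Fintype.card Λ : ℝ) / 2 := le_trans (by exact_mod_cast ha) hM
  push_cast at ha1
  have hV0 : (0 : ℝ) ≤ (Fintype.card Λ : ℝ) := by positivity
  have h2a : 2 * ((a : ℝ) + 1) ≤ (Fintype.card Λ : ℝ) := by nlinarith
  have haV' : ((a + 1 : ℕ) : ℝ) ≤ (Fintype.card Λ : ℝ) := by push_cast; linarith
  have haV : a < Fintype.card Λ := by exact_mod_cast haV'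
  have ht := (partitionFn_spinSector_transfer_up hH hP hβ (fun x => norm_commutator_dGamma_creation_le h hsym hrow (orb x 0)) haV b).1
  rw [← re_trace_spinSectorProj_mul_gibbsWeight_eq hP, ← re_trace_spinSectorProj_mul_gibbsWeight_eq hP] at ht
  have hZ₁ : 0 ≤ ((spinSectorProj (a + 1) b * gibbsWeight β (dGamma h)).trace).re :=
    (Complex.nonneg_iff.1 (trace_spinSectorProj_mul_gibbsWeight_nonneg hH hP β (a + 1) b)).1
  have hVa : (0 : ℝ) < (Fintype.card Λ : ℝ) - a := by linarith
  -- the exponential factor: `βκ|Λ|/(|Λ|−a) ≤ 2κβ` since `2a ≤ |Λ|`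
  have hexp : Real.exp (β * ((Fintype.card Λ : ℝ) * κ) / ((Fintype.card Λ : ℝ) - a)) ≤ Real.exp (2 * κ * β) := by
    apply Real.exp_le_exp.2
    rw [div_le_iff₀ hVa]
    have hβκ : 0 ≤ β * κ := mul_nonneg hβ hκ
    nlinarith
  -- the combinatorial factor: `(a+1) ≤ (n/(2−n)) (|Λ|−a)`
  have hn2 : (0 : ℝ) < 2 - n := by linarith
  have hfrac : ((a : ℝ) + 1) ≤ n / (2 - n) * ((Fintype.card Λ : ℝ) - a) := by
    rw [div_mul_eq_mul_div, le_div_iff₀ hn2]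
    nlinarith
  refine le_of_mul_le_mul_left ?_ hVa
  calc ((Fintype.card Λ : ℝ) - a) * ((spinSectorProj a b * gibbsWeight β (dGamma h)).trace).re
      ≤ Real.exp (β * ((Fintype.card Λ : ℝ) * κ) / ((Fintype.card Λ : ℝ) - a)) *
          (((a : ℝ) + 1) * ((spinSectorProj (a + 1) b * gibbsWeight β (dGamma h)).trace).re) := ht
    _ = (Real.exp (β * ((Fintype.card Λ : ℝ) * κ) / ((Fintype.card Λ : ℝ) - a)) * ((a : ℝ) + 1)) *
          ((spinSectorProj (a + 1) b * gibbsWeight β (dGamma h)).trace).re := by ring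
    _ ≤ (Real.exp (2 * κ * β) * (n / (2 - n) * ((Fintype.card Λ : ℝ) - a))) *
          ((spinSectorProj (a + 1) b * gibbsWeight β (dGamma h)).trace).re :=
        mul_le_mul_of_nonneg_right (mul_le_mul hexp hfrac (by positivity) (by positivity)) hZ₁
    _ = ((Fintype.card Λ : ℝ) - a) * ((n / (2 - n) * Real.exp (2 * κ * β)) *
          ((spinSectorProj (a + 1) b * gibbsWeight β (dGamma h)).trace).re) := by ring

/-- **One-step sector ratio, spin down**: for `β ≥ 0`, `0 ≤ n ≤ 1` and `b + 1 ≤ M ≤ n|Λ|/2`,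
`Z(a, b) ≤ (n/(2−n)) e^{2κβ} · Z(a, b+1)`. -/
theorem sectorTrace_down_le_mul_succ {β n : ℝ} (hβ : 0 ≤ β) (hn0 : 0 ≤ n) (hn1 : n ≤ 1) {M : ℕ}
    (hM : (M : ℝ) ≤ n * (Fintype.card Λ : ℝ) / 2) (a : ℕ) {b : ℕ} (hb : b + 1 ≤ M) :
    ((spinSectorProj a b * gibbsWeight β (dGamma h)).trace).re ≤
      (n / (2 - n) * Real.exp (2 * κ * β)) * ((spinSectorProj a (b + 1) * gibbsWeight β (dGamma h)).trace).re := by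
  have hH := isHermitian_dGamma hh
  have hP := preservesSectors_dGamma_of_spinDiag h hspin
  have hb1 : ((b + 1 : ℕ) : ℝ) ≤ n * (Fintype.card Λ : ℝ) / 2 := le_trans (by exact_mod_cast hb) hM
  push_cast at hb1
  have hV0 : (0 : ℝ) ≤ (Fintype.card Λ : ℝ) := by positivity
  have h2b : 2 * ((b : ℝ) + 1) ≤ (Fintype.card Λ : ℝ) := by nlinarith
  have hbV' : ((b + 1 : ℕ) : ℝ) ≤ (Fintype.card Λ : ℝ) := by push_cast; linarith
  have hbV : b < Fintype.card Λ := by exact_mod_cast hbV'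
  have ht := (partitionFn_spinSector_transfer_down hH hP hβ (fun x => norm_commutator_dGamma_creation_le h hsym hrow (orb x 1)) a hbV).1
  rw [← re_trace_spinSectorProj_mul_gibbsWeight_eq hP, ← re_trace_spinSectorProj_mul_gibbsWeight_eq hP] at ht
  have hZ₁ : 0 ≤ ((spinSectorProj a (b + 1) * gibbsWeight β (dGamma h)).trace).re :=
    (Complex.nonneg_iff.1 (trace_spinSectorProj_mul_gibbsWeight_nonneg hH hP β a (b + 1))).1
  have hVb : (0 : ℝ) < (Fintype.card Λ : ℝ) - b := by linarith
  have hexp : Real.exp (β * ((Fintype.card Λ : ℝ) * κ) / ((Fintype.card Λ : ℝ) - b)) ≤ Real.exp (2 * κ * β) := by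
    apply Real.exp_le_exp.2
    rw [div_le_iff₀ hVb]
    have hβκ : 0 ≤ β * κ := mul_nonneg hβ hκ
    nlinarith
  have hn2 : (0 : ℝ) < 2 - n := by linarith
  have hfrac : ((b : ℝ) + 1) ≤ n / (2 - n) * ((Fintype.card Λ : ℝ) - b) := by
    rw [div_mul_eq_mul_div, le_div_iff₀ hn2]
    nlinarith
  refine le_of_mul_le_mul_left ?_ hVb
  calc ((Fintype.card Λ : ℝ) - b) * ((spinSectorProj a b * gibbsWeight β (dGamma h)).trace).re
      ≤ Real.exp (β * ((Fintype.card Λ : ℝ) * κ) / ((Fintype.card Λ : ℝ) - b)) *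
          (((b : ℝ) + 1) * ((spinSectorProj a (b + 1) * gibbsWeight β (dGamma h)).trace).re) := ht
    _ = (Real.exp (β * ((Fintype.card Λ : ℝ) * κ) / ((Fintype.card Λ : ℝ) - b)) * ((b : ℝ) + 1)) *
          ((spinSectorProj a (b + 1) * gibbsWeight β (dGamma h)).trace).re := by ring
    _ ≤ (Real.exp (2 * κ * β) * (n / (2 - n) * ((Fintype.card Λ : ℝ) - b))) *
          ((spinSectorProj a (b + 1) * gibbsWeight β (dGamma h)).trace).re :=
        mul_le_mul_of_nonneg_right (mul_le_mul hexp hfrac (by positivity) (by positivity)) hZ₁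
    _ = ((Fintype.card Λ : ℝ) - b) * ((n / (2 - n) * Real.exp (2 * κ * β)) *
          ((spinSectorProj a (b + 1) * gibbsWeight β (dGamma h)).trace).re) := by ring

/-- **Iterated sector ratio, spin up**: `Z(M−i, b) ≤ ρ^i Z(M, b)`, `ρ = (n/(2−n)) e^{2κβ}`, for `i ≤ M ≤ n|Λ|/2`. -/
theorem sectorTrace_up_sub_le {β n : ℝ} (hβ : 0 ≤ β) (hn0 : 0 ≤ n) (hn1 : n ≤ 1) {M : ℕ}
    (hM : (M : ℝ) ≤ n * (Fintype.card Λ : ℝ) / 2) (b : ℕ) : ∀ i : ℕ, i ≤ M →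
    ((spinSectorProj (M - i) b * gibbsWeight β (dGamma h)).trace).re ≤
      (n / (2 - n) * Real.exp (2 * κ * β)) ^ i * ((spinSectorProj M b * gibbsWeight β (dGamma h)).trace).re := by
  intro i
  induction i with
  | zero => intro _; rw [Nat.sub_zero, pow_zero, one_mul]
  | succ i ih =>
    intro hi
    have h1 := sectorTrace_up_le_mul_succ h hh hsym hspin hκ hrow hβ hn0 hn1 hM (a := M - (i + 1)) (by omega) b
    rw [show M - (i + 1) + 1 = M - i by omega] at h1
    have hρ : 0 ≤ n / (2 - n) * Real.exp (2 * κ * β) := by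
      have : (0 : ℝ) < 2 - n := by linarith
      positivity
    calc _ ≤ (n / (2 - n) * Real.exp (2 * κ * β)) * ((spinSectorProj (M - i) b * gibbsWeight β (dGamma h)).trace).re := h1
      _ ≤ (n / (2 - n) * Real.exp (2 * κ * β)) * ((n / (2 - n) * Real.exp (2 * κ * β)) ^ i *
          ((spinSectorProj M b * gibbsWeight β (dGamma h)).trace).re) := mul_le_mul_of_nonneg_left (ih (by omega)) hρ
      _ = _ := by rw [pow_succ]; ring

/-- **Iterated sector ratio, spin down**: `Z(a, M−i) ≤ ρ^i Z(a, M)` for `i ≤ M ≤ n|Λ|/2`. -/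
theorem sectorTrace_down_sub_le {β n : ℝ} (hβ : 0 ≤ β) (hn0 : 0 ≤ n) (hn1 : n ≤ 1) {M : ℕ}
    (hM : (M : ℝ) ≤ n * (Fintype.card Λ : ℝ) / 2) (a : ℕ) : ∀ i : ℕ, i ≤ M →
    ((spinSectorProj a (M - i) * gibbsWeight β (dGamma h)).trace).re ≤
      (n / (2 - n) * Real.exp (2 * κ * β)) ^ i * ((spinSectorProj a M * gibbsWeight β (dGamma h)).trace).re := by
  intro i
  induction i with
  | zero => intro _; rw [Nat.sub_zero, pow_zero, one_mul]
  | succ i ih =>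
    intro hi
    have h1 := sectorTrace_down_le_mul_succ h hh hsym hspin hκ hrow hβ hn0 hn1 hM a (b := M - (i + 1)) (by omega)
    rw [show M - (i + 1) + 1 = M - i by omega] at h1
    have hρ : 0 ≤ n / (2 - n) * Real.exp (2 * κ * β) := by
      have : (0 : ℝ) < 2 - n := by linarith
      positivity
    calc _ ≤ (n / (2 - n) * Real.exp (2 * κ * β)) * ((spinSectorProj a (M - i) * gibbsWeight β (dGamma h)).trace).re := h1
      _ ≤ (n / (2 - n) * Real.exp (2 * κ * β)) * ((n / (2 - n) * Real.exp (2 * κ * β)) ^ i *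
          ((spinSectorProj a M * gibbsWeight β (dGamma h)).trace).re) := mul_le_mul_of_nonneg_left (ih (by omega)) hρ
      _ = _ := by rw [pow_succ]; ring

end Ratio

end Summit.Ventures.CertifiedManyBodySolver.Theorems.TcThermcert1.FreeGasCurrentClustering

end
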